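import Summits.ResolutionOfSingularities.ResolutionOfSingularities.Theorems.WildQuotientsSummitReductionStubPairOrbitNormalFormBlowupChartsOverCentreNode2
import Summits.ResolutionOfSingularities.ResolutionOfSingularities.Theorems.WildQuotientsSummitReductionStubPairOrbitNormalFormBlowupChartsOverCentreNodeDataAux
import Summits.ResolutionOfSingularities.ResolutionOfSingularities.Theorems.WildQuotientsSummitReductionStubPairOrbitNormalFormBlowupChartsOverCentreChartT
import Summits.ResolutionOfSingularities.ResolutionOfSingularities.Theorems.WildQuotientsSummitReductionStubPairOrbitNormalFormBlowupModelSing2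
import HarnessLib

/-!
# `WildQuotients.SummitReduction` (stmt-ResolutionOfSingularities-16324), line `FramePerfect`, stub O3
# (`stub_pair_orbitNormalFormBlowup_chartsOverCentre`): the node data at a closed point of the new
# double locus

Route `ResolutionOfSingularities/WildQuotients`, crux `SummitReduction`; helper file of stub O3
(de Jong 1996, 4.27 [C2], coefficient-free model; continuation of `…ChartsOverCentreNode2.lean`).
PROVED here: `chartsOverCentre_node_data` — at a closed point `𝔔 ∋ u', v'` of the chart
"`t₁ ≠ 0`" over the closed point with at least two vanishing factors in `t₂' t₃ ⋯ t_s`, the NEW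
base `A' = Â₁` (completion of the chart of the blown-up base) with a regular system of
parameters `t'` reindexed so that the `s'` branches through the node come first and the `r'`
boundary branches next (the unit `t₂' = y/x`, when invertible, absorbed into one parameter),
and `𝒪̂ ≅ A'⟦U, V⟧/(UV - ∏_{i<s'} t'ᵢ)` (`chartsOverCentre_node_completionEquiv`) carrying
constants to constants and `x · (y/x) · ∏_T w ↦ ∏_{i<r'} t'ᵢ` — de Jong 1996, p. 76: "again of
normal form … `Z'` is given by `t₁t₂'t₃ ⋯ t_r = 0`".

## Sources

* A. J. de Jong, *Smoothness, semi-stability and alterations*, Publ. Math. IHÉS 83 (1996), 4.27,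
  p. 76. [DeJong1996]
* A. J. de Jong, *Families of curves and alterations*, Ann. Inst. Fourier 47 (1997), proof of
  Prop. 5.11, p. 619. [DeJong1997]
-/

set_option linter.dupNamespace false -- the tree's summit namespace repeats `ResolutionOfSingularities`

noncomputable section

open IsLocalRing
open Literature.AlgebraicGeometry.Resolution
open Literature.NumberTheory.GaloisRepresentations.NearlyOrdinaryPresentationCA

namespace Summit.ResolutionOfSingularities.ResolutionOfSingularities.Theorems

/-- The initial segment `{i < s}` of `Fin N` has `s` elements (`s ≤ N`). [folklore] -/
theorem chartsOverCentre_card_filter_val_lt {N s : ℕ} (h : s ≤ N) :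
    (Finset.univ.filter (fun i : Fin N => i.val < s)).card = s := by
  rw [Finset.filter_val_lt_eq_map_castLEEmb h, Finset.card_map, Finset.card_univ, Fintype.card_fin]

set_option maxHeartbeats 30000000 in
/-- **The node data at a closed point of the new double locus** (de Jong 1996, p. 76, chart
"`t₁ ≠ 0`" with at least two vanishing factors in `t₂' t₃ ⋯ t_s`: "again of normal form"): the
NEW base `A' = Â₁`, a regular system of parameters `t'` of `A'` reindexed so that the `s'`
branches through the node come first and the `r'` boundary branches next, and
`𝒪̂ ≅ A'⟦U, V⟧/(UV - ∏_{i<s'} t'ᵢ)` carrying constants to constants, the exceptional generator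
`x` and `y/x` to known parameters (times a unit absorbed into `t'`), with
`x · (y/x) · ∏_{k ∈ T} w_k ↦ ∏_{i<r'} t'ᵢ`. [cite: DeJong1996, 4.27, p. 76] -/
theorem chartsOverCentre_node_data {A : Type} [CommRing A] [IsRegularLocalRing A] {l : ℕ}
    (x y : A) (w : Fin l → A) (S T : Finset (Fin l)) (hST : S ⊆ T)
    (hzA : Ideal.span (Set.range (Fin.append ![x, y] w)) = maximalIdeal A)
    (hdA : (maximalIdeal A).spanFinrank = 2 + l)
    (hy : y ∈ (Ideal.span (Set.range ![x, y]))) (h0 : MvPowerSeries.X 0 ∈ (Ideal.span (Set.range (![MvPowerSeries.X 0, MvPowerSeries.X 1, MvPowerSeries.C x, MvPowerSeries.C y] : Fin 4 → MvPowerSeries (Fin 2) A)))) (h1 : MvPowerSeries.X 1 ∈ (Ideal.span (Set.range (![MvPowerSeries.X 0, MvPowerSeries.X 1, MvPowerSeries.C x, MvPowerSeries.C y] : Fin 4 → MvPowerSeries (Fin 2) A))))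
    (h2 : MvPowerSeries.C x ∈ (Ideal.span (Set.range (![MvPowerSeries.X 0, MvPowerSeries.X 1, MvPowerSeries.C x, MvPowerSeries.C y] : Fin 4 → MvPowerSeries (Fin 2) A)))) (h3 : MvPowerSeries.C y ∈ (Ideal.span (Set.range (![MvPowerSeries.X 0, MvPowerSeries.X 1, MvPowerSeries.C x, MvPowerSeries.C y] : Fin 4 → MvPowerSeries (Fin 2) A))))
    (𝔔 : Ideal (blowupAlgebra (Ideal.span (Set.range (![MvPowerSeries.X 0, MvPowerSeries.X 1, MvPowerSeries.C x, MvPowerSeries.C y] : Fin 4 → MvPowerSeries (Fin 2) A))) (MvPowerSeries.C x))) [𝔔.IsMaximal]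
    (h𝔔 : 𝔔.comap (algebraMap (MvPowerSeries (Fin 2) A) (blowupAlgebra (Ideal.span (Set.range (![MvPowerSeries.X 0, MvPowerSeries.X 1, MvPowerSeries.C x, MvPowerSeries.C y] : Fin 4 → MvPowerSeries (Fin 2) A))) (MvPowerSeries.C x))) = maximalIdeal (MvPowerSeries (Fin 2) A))
    (he0 : blowupAlgebra.gen (Ideal.span (Set.range (![MvPowerSeries.X 0, MvPowerSeries.X 1, MvPowerSeries.C x, MvPowerSeries.C y] : Fin 4 → MvPowerSeries (Fin 2) A))) (MvPowerSeries.C x) (MvPowerSeries.X 0) h0 ∈ 𝔔) (he1 : blowupAlgebra.gen (Ideal.span (Set.range (![MvPowerSeries.X 0, MvPowerSeries.X 1, MvPowerSeries.C x, MvPowerSeries.C y] : Fin 4 → MvPowerSeries (Fin 2) A))) (MvPowerSeries.C x) (MvPowerSeries.X 1) h1 ∈ 𝔔)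
    (hν : (blowupAlgebra.gen (Ideal.span (Set.range (![MvPowerSeries.X 0, MvPowerSeries.X 1, MvPowerSeries.C x, MvPowerSeries.C y] : Fin 4 → MvPowerSeries (Fin 2) A))) (MvPowerSeries.C x) (MvPowerSeries.C y) h3 ∈ 𝔔 ∧ S.Nonempty) ∨ 2 ≤ S.card)
    (L : Type) [CommRing L] [IsLocalRing L] [Algebra (blowupAlgebra (Ideal.span (Set.range (![MvPowerSeries.X 0, MvPowerSeries.X 1, MvPowerSeries.C x, MvPowerSeries.C y] : Fin 4 → MvPowerSeries (Fin 2) A))) (MvPowerSeries.C x)) L] [IsLocalization.AtPrime L 𝔔]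
    [IsLocalRing (L ⧸ Ideal.span {algebraMap (blowupAlgebra (Ideal.span (Set.range (![MvPowerSeries.X 0, MvPowerSeries.X 1, MvPowerSeries.C x, MvPowerSeries.C y] : Fin 4 → MvPowerSeries (Fin 2) A))) (MvPowerSeries.C x)) L (blowupAlgebra.gen (Ideal.span (Set.range (![MvPowerSeries.X 0, MvPowerSeries.X 1, MvPowerSeries.C x, MvPowerSeries.C y] : Fin 4 → MvPowerSeries (Fin 2) A))) (MvPowerSeries.C x) (MvPowerSeries.X 0) h0 * blowupAlgebra.gen (Ideal.span (Set.range (![MvPowerSeries.X 0, MvPowerSeries.X 1, MvPowerSeries.C x, MvPowerSeries.C y] : Fin 4 → MvPowerSeries (Fin 2) A))) (MvPowerSeries.C x) (MvPowerSeries.X 1) h1 - blowupAlgebra.gen (Ideal.span (Set.range (![MvPowerSeries.X 0, MvPowerSeries.X 1, MvPowerSeries.C x, MvPowerSeries.C y] : Fin 4 → MvPowerSeries (Fin 2) A))) (MvPowerSeries.C x) (MvPowerSeries.C x) h2 * blowupAlgebra.gen (Ideal.span (Set.range (![MvPowerSeries.X 0, MvPowerSeries.X 1, MvPowerSeries.C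 x, MvPowerSeries.C y] : Fin 4 → MvPowerSeries (Fin 2) A))) (MvPowerSeries.C x) (MvPowerSeries.C y) h3 * algebraMap (MvPowerSeries (Fin 2) A) (blowupAlgebra (Ideal.span (Set.range (![MvPowerSeries.X 0, MvPowerSeries.X 1, MvPowerSeries.C x, MvPowerSeries.C y] : Fin 4 → MvPowerSeries (Fin 2) A))) (MvPowerSeries.C x)) (MvPowerSeries.C (∏ k ∈ S, w k)))})] :
    ∃ (A' : Type) (_ : CommRing A') (_ : IsRegularLocalRing A') (t' : Fin (l + 2) → A') (s' r' : ℕ)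
      (ι : A →+* A') (u3 : A')
      (e : AdicCompletion (maximalIdeal (L ⧸ Ideal.span {algebraMap (blowupAlgebra (Ideal.span (Set.range (![MvPowerSeries.X 0, MvPowerSeries.X 1, MvPowerSeries.C x, MvPowerSeries.C y] : Fin 4 → MvPowerSeries (Fin 2) A))) (MvPowerSeries.C x)) L (blowupAlgebra.gen (Ideal.span (Set.range (![MvPowerSeries.X 0, MvPowerSeries.X 1, MvPowerSeries.C x, MvPowerSeries.C y] : Fin 4 → MvPowerSeries (Fin 2) A))) (MvPowerSeries.C x) (MvPowerSeries.X 0) h0 * blowupAlgebra.gen (Ideal.span (Set.range (![MvPowerSeries.X 0, MvPowerSeries.X 1, MvPowerSeries.C x, MvPowerSeries.C y] : Fin 4 → MvPowerSeries (Fin 2) A))) (MvPowerSeries.C x) (MvPowerSeries.X 1) h1 - blowupAlgebra.gen (Ideal.span (Set.range (![MvPowerSeries.X 0, MvPowerSeries.X 1, MvPowerSeries.C x, MvPowerSeries.C y] : Fin 4 → MvPowerSeries (Fin 2) A))) (MvPowerSeries.C x) (MvPowerSeries.C x) h2 * blowupAlgebra.gen (Ideal.span (Set.range (![MvPowerSeries.X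 0, MvPowerSeries.X 1, MvPowerSeries.C x, MvPowerSeries.C y] : Fin 4 → MvPowerSeries (Fin 2) A))) (MvPowerSeries.C x) (MvPowerSeries.C y) h3 * algebraMap (MvPowerSeries (Fin 2) A) (blowupAlgebra (Ideal.span (Set.range (![MvPowerSeries.X 0, MvPowerSeries.X 1, MvPowerSeries.C x, MvPowerSeries.C y] : Fin 4 → MvPowerSeries (Fin 2) A))) (MvPowerSeries.C x)) (MvPowerSeries.C (∏ k ∈ S, w k)))})) (L ⧸ Ideal.span {algebraMap (blowupAlgebra (Ideal.span (Set.range (![MvPowerSeries.X 0, MvPowerSeries.X 1, MvPowerSeries.C x, MvPowerSeries.C y] : Fin 4 → MvPowerSeries (Fin 2) A))) (MvPowerSeries.C x)) L (blowupAlgebra.gen (Ideal.span (Set.range (![MvPowerSeries.X 0, MvPowerSeries.X 1, MvPowerSeries.C x, MvPowerSeries.C y] : Fin 4 → MvPowerSeries (Fin 2) A))) (MvPowerSeries.C x) (MvPowerSeries.X 0) h0 * blowupAlgebra.gen (Ideal.span (Set.range (![MvPowerSeries.X 0, MvPowerSeries.X 1, MvPowerSeries.C x, MvPowerSeries.C y]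 : Fin 4 → MvPowerSeries (Fin 2) A))) (MvPowerSeries.C x) (MvPowerSeries.X 1) h1 - blowupAlgebra.gen (Ideal.span (Set.range (![MvPowerSeries.X 0, MvPowerSeries.X 1, MvPowerSeries.C x, MvPowerSeries.C y] : Fin 4 → MvPowerSeries (Fin 2) A))) (MvPowerSeries.C x) (MvPowerSeries.C x) h2 * blowupAlgebra.gen (Ideal.span (Set.range (![MvPowerSeries.X 0, MvPowerSeries.X 1, MvPowerSeries.C x, MvPowerSeries.C y] : Fin 4 → MvPowerSeries (Fin 2) A))) (MvPowerSeries.C x) (MvPowerSeries.C y) h3 * algebraMap (MvPowerSeries (Fin 2) A) (blowupAlgebra (Ideal.span (Set.range (![MvPowerSeries.X 0, MvPowerSeries.X 1, MvPowerSeries.C x, MvPowerSeries.C y] : Fin 4 → MvPowerSeries (Fin 2) A))) (MvPowerSeries.C x)) (MvPowerSeries.C (∏ k ∈ S, w k)))}) ≃+*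
        DeJong1996.NodeDeformationRing A' (∏ i ∈ Finset.univ.filter (fun i : Fin (l + 2) => i.val < s'), t' i)),
      Ideal.span (Set.range t') = maximalIdeal A' ∧ ringKrullDim A' = (l + 2 : ℕ) ∧
      2 ≤ s' ∧ s' ≤ r' ∧ r' ≤ l + 2 ∧
      (∀ a : A, e (algebraMap (L ⧸ Ideal.span {algebraMap (blowupAlgebra (Ideal.span (Set.range (![MvPowerSeries.X 0, MvPowerSeries.X 1, MvPowerSeries.C x, MvPowerSeries.C y] : Fin 4 → MvPowerSeries (Fin 2) A))) (MvPowerSeries.C x)) L (blowupAlgebra.gen (Ideal.span (Set.range (![MvPowerSeries.X 0, MvPowerSeries.X 1, MvPowerSeries.C x, MvPowerSeries.C y] : Fin 4 → MvPowerSeries (Fin 2) A))) (MvPowerSeries.C x) (MvPowerSeries.X 0) h0 * blowupAlgebra.gen (Ideal.span (Set.range (![MvPowerSeries.X 0, MvPowerSeries.X 1, MvPowerSeries.C x, MvPowerSeries.C y] : Fin 4 → MvPowerSeries (Fin 2) A))) (MvPowerSeries.C x) (MvPowerSeries.X 1) h1 - blowupAlgebra.gen (Ideal.span (Set.range (![MvPowerSeries.X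 0, MvPowerSeries.X 1, MvPowerSeries.C x, MvPowerSeries.C y] : Fin 4 → MvPowerSeries (Fin 2) A))) (MvPowerSeries.C x) (MvPowerSeries.C x) h2 * blowupAlgebra.gen (Ideal.span (Set.range (![MvPowerSeries.X 0, MvPowerSeries.X 1, MvPowerSeries.C x, MvPowerSeries.C y] : Fin 4 → MvPowerSeries (Fin 2) A))) (MvPowerSeries.C x) (MvPowerSeries.C y) h3 * algebraMap (MvPowerSeries (Fin 2) A) (blowupAlgebra (Ideal.span (Set.range (![MvPowerSeries.X 0, MvPowerSeries.X 1, MvPowerSeries.C x, MvPowerSeries.C y] : Fin 4 → MvPowerSeries (Fin 2) A))) (MvPowerSeries.C x)) (MvPowerSeries.C (∏ k ∈ S, w k)))}) _ (Ideal.Quotient.mk _ (algebraMap (blowupAlgebra (Ideal.span (Set.range (![MvPowerSeries.X 0, MvPowerSeries.X 1, MvPowerSeries.C x, MvPowerSeries.C y] : Fin 4 → MvPowerSeries (Fin 2) A))) (MvPowerSeries.C x)) L (algebraMap (MvPowerSeries (Fin 2) A) (blowupAlgebra (Ideal.span (Set.range (![MvPowerSeries.X 0, MvPowerSeries.X 1,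 MvPowerSeries.C x, MvPowerSeries.C y] : Fin 4 → MvPowerSeries (Fin 2) A))) (MvPowerSeries.C x)) (MvPowerSeries.C a))))) =
        DeJong1996.NodeDeformationRing.ofBase A' _ (ι a)) ∧
      e (algebraMap (L ⧸ Ideal.span {algebraMap (blowupAlgebra (Ideal.span (Set.range (![MvPowerSeries.X 0, MvPowerSeries.X 1, MvPowerSeries.C x, MvPowerSeries.C y] : Fin 4 → MvPowerSeries (Fin 2) A))) (MvPowerSeries.C x)) L (blowupAlgebra.gen (Ideal.span (Set.range (![MvPowerSeries.X 0, MvPowerSeries.X 1, MvPowerSeries.C x, MvPowerSeries.C y] : Fin 4 → MvPowerSeries (Fin 2) A))) (MvPowerSeries.C x) (MvPowerSeries.X 0) h0 * blowupAlgebra.gen (Ideal.span (Set.range (![MvPowerSeries.X 0, MvPowerSeries.X 1, MvPowerSeries.C x, MvPowerSeries.C y] : Fin 4 → MvPowerSeries (Fin 2) A))) (MvPowerSeries.C x) (MvPowerSeries.X 1) h1 - blowupAlgebra.gen (Ideal.span (Set.range (![MvPowerSeries.X 0, MvPowerSeries.X 1, MvPowerSeries.C x, MvPowerSeries.C y] :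 Fin 4 → MvPowerSeries (Fin 2) A))) (MvPowerSeries.C x) (MvPowerSeries.C x) h2 * blowupAlgebra.gen (Ideal.span (Set.range (![MvPowerSeries.X 0, MvPowerSeries.X 1, MvPowerSeries.C x, MvPowerSeries.C y] : Fin 4 → MvPowerSeries (Fin 2) A))) (MvPowerSeries.C x) (MvPowerSeries.C y) h3 * algebraMap (MvPowerSeries (Fin 2) A) (blowupAlgebra (Ideal.span (Set.range (![MvPowerSeries.X 0, MvPowerSeries.X 1, MvPowerSeries.C x, MvPowerSeries.C y] : Fin 4 → MvPowerSeries (Fin 2) A))) (MvPowerSeries.C x)) (MvPowerSeries.C (∏ k ∈ S, w k)))}) _ (Ideal.Quotient.mk _ (algebraMap (blowupAlgebra (Ideal.span (Set.range (![MvPowerSeries.X 0, MvPowerSeries.X 1, MvPowerSeries.C x, MvPowerSeries.C y] : Fin 4 → MvPowerSeries (Fin 2) A))) (MvPowerSeries.C x)) L (blowupAlgebra.gen (Ideal.span (Set.range (![MvPowerSeries.X 0, MvPowerSeries.X 1, MvPowerSeries.C x, MvPowerSeries.C y] : Fin 4 → MvPowerSeries (Fin 2) A))) (MvPowerSeries.C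 x) (MvPowerSeries.C y) h3)))) = DeJong1996.NodeDeformationRing.ofBase A' _ u3 ∧
      ι x * u3 * ι (∏ k ∈ T, w k) = ∏ i ∈ Finset.univ.filter (fun i : Fin (l + 2) => i.val < r'), t' i ∧
      ι x ∈ nonZeroDivisors A' := by
  classical
  have hN := chartsOverCentre_node_completionEquiv x y w (∏ k ∈ S, w k) hzA hdA hy h0 h1 h2 h3 𝔔 h𝔔 he0 he1 L
  rcases hN with ⟨lam, 𝔔₁, hrest⟩
  rcases hrest with ⟨hmax, hrest⟩
  rcases hrest with ⟨h𝔔₁, hlamC, hlam3, hd, hL1⟩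
  haveI := hmax
  -- the new base `A' = Â₁`
  obtain ⟨e₀, he₀⟩ := hL1 (Localization.AtPrime 𝔔₁)
  have hcA : ∀ k, (![x, y] : Fin 2 → A) k ∈ (Ideal.span (Set.range ![x, y])) := fun k => Ideal.subset_span ⟨k, rfl⟩
  haveI hA1N : IsNoetherianRing (blowupAlgebra (Ideal.span (Set.range ![x, y])) x) := by
    obtain ⟨Λ, -, -⟩ := chartsOverCentre_exists_reesChart_equiv (![x, y] : Fin 2 → A) 0 (Ideal.span (Set.range ![x, y])) rfl hcA
    haveI : IsNoetherianRing (chartRing (![x, y] : Fin 2 → A) 0) := isNoetherianRing_blowupChart _ 0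
    exact isNoetherianRing_of_ringEquiv (chartRing (![x, y] : Fin 2 → A) 0) Λ
  haveI hL1N : IsNoetherianRing (Localization.AtPrime 𝔔₁) :=
    IsLocalization.isNoetherianRing 𝔔₁.primeCompl _ hA1N
  obtain ⟨OF1, hOF1, hOF1rs⟩ := chartsOverCentre_exists_ofLocalCpl (Localization.AtPrime 𝔔₁)
  simp_rw [← hOF1] at he₀
  have hdim1 : ringKrullDim (Localization.AtPrime 𝔔₁) = ((2 - 1) + (l + 1) : ℕ) :=
    chartsOverCentre_ringKrullDim_chart_of_eq (![x, y] : Fin 2 → A) 0 w hzA hdA (Ideal.span (Set.range ![x, y])) rfl hcA x rfl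
      𝔔₁ hd (Localization.AtPrime 𝔔₁)
  -- notation-free abbreviations of the structure maps
  have he3iff : blowupAlgebra.gen (Ideal.span (Set.range ![x, y])) x y hy ∈ 𝔔₁ ↔ blowupAlgebra.gen (Ideal.span (Set.range (![MvPowerSeries.X 0, MvPowerSeries.X 1, MvPowerSeries.C x, MvPowerSeries.C y] : Fin 4 → MvPowerSeries (Fin 2) A))) (MvPowerSeries.C x) (MvPowerSeries.C y) h3 ∈ 𝔔 := by rw [h𝔔₁, Ideal.mem_comap, hlam3]
  haveI hAreg : IsRegularLocalRing (LocalCpl (Localization.AtPrime 𝔔₁)) := by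
    have := chartsOverCentre_isRsopPart_chartFamily_of_eq (![x, y] : Fin 2 → A) 0 w hzA hdA (Ideal.span (Set.range ![x, y])) rfl hcA
      x rfl 𝔔₁ hd (Localization.AtPrime 𝔔₁) (a := 0) Fin.elim0 (Function.injective_of_subsingleton _)
      (fun t => Fin.elim0 t)
    haveI := this.isRegularLocalRing
    exact isRegularLocalRing_adicCompletion _
  haveI : IsDomain (LocalCpl (Localization.AtPrime 𝔔₁)) := isDomain_of_isRegularLocalRing _
  have hdimA : ringKrullDim (LocalCpl (Localization.AtPrime 𝔔₁)) = ((l + 2 : ℕ) : WithBot ℕ∞) := by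
    rw [show ringKrullDim (LocalCpl (Localization.AtPrime 𝔔₁)) = ringKrullDim (Localization.AtPrime 𝔔₁) from ringKrullDim_adicCompletion _, hdim1]
    congr 1
    omega
  -- values of the chart family
  have hz0 : ∀ {a : ℕ} (jJ : Fin a → {k : Fin 2 // k ≠ 0}), OF1 (chartFamily (![x, y] : Fin 2 → A) 0 w (Localization.AtPrime 𝔔₁) (algebraMap A (blowupAlgebra (Ideal.span (Set.range ![x, y])) x)) (fun k => blowupAlgebra.gen (Ideal.span (Set.range ![x, y])) x ((![x, y] : Fin 2 → A) k) (hcA k)) jJ 0) = ((OF1).comp ((algebraMap (blowupAlgebra (Ideal.span (Set.range ![x, y])) x) (Localization.AtPrime 𝔔₁)).comp (algebraMap A (blowupAlgebra (Ideal.span (Set.range ![x, y])) x)))) x := fun jJ => by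
    rw [chartsOverCentre_chartFamily_zero]; rfl
  have hzw : ∀ {a : ℕ} (jJ : Fin a → {k : Fin 2 // k ≠ 0}) (k : Fin l),
      OF1 (chartFamily (![x, y] : Fin 2 → A) 0 w (Localization.AtPrime 𝔔₁) (algebraMap A (blowupAlgebra (Ideal.span (Set.range ![x, y])) x)) (fun k => blowupAlgebra.gen (Ideal.span (Set.range ![x, y])) x ((![x, y] : Fin 2 → A) k) (hcA k)) jJ (Fin.natAdd a k).succ) = ((OF1).comp ((algebraMap (blowupAlgebra (Ideal.span (Set.range ![x, y])) x) (Localization.AtPrime 𝔔₁)).comp (algebraMap A (blowupAlgebra (Ideal.span (Set.range ![x, y])) x)))) (w k) := fun jJ k => by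
    rw [chartsOverCentre_chartFamily_w]; rfl
  -- the compatibilities of `e₀`
  have heC : ∀ a : A, e₀ (algebraMap (L ⧸ Ideal.span {algebraMap (blowupAlgebra (Ideal.span (Set.range (![MvPowerSeries.X 0, MvPowerSeries.X 1, MvPowerSeries.C x, MvPowerSeries.C y] : Fin 4 → MvPowerSeries (Fin 2) A))) (MvPowerSeries.C x)) L (blowupAlgebra.gen (Ideal.span (Set.range (![MvPowerSeries.X 0, MvPowerSeries.X 1, MvPowerSeries.C x, MvPowerSeries.C y] : Fin 4 → MvPowerSeries (Fin 2) A))) (MvPowerSeries.C x) (MvPowerSeries.X 0) h0 * blowupAlgebra.gen (Ideal.span (Set.range (![MvPowerSeries.X 0, MvPowerSeries.X 1, MvPowerSeries.C x, MvPowerSeries.C y] : Fin 4 → MvPowerSeries (Fin 2) A))) (MvPowerSeries.C x) (MvPowerSeries.X 1) h1 - blowupAlgebra.gen (Ideal.span (Set.range (![MvPowerSeries.X 0, MvPowerSeries.X 1, MvPowerSeries.C x, MvPowerSeries.C y] : Fin 4 → MvPowerSeries (Fin 2) A))) (MvPowerSeries.C x) (MvPowerSeries.C x) h2 * blowupAlgebra.gen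 (Ideal.span (Set.range (![MvPowerSeries.X 0, MvPowerSeries.X 1, MvPowerSeries.C x, MvPowerSeries.C y] : Fin 4 → MvPowerSeries (Fin 2) A))) (MvPowerSeries.C x) (MvPowerSeries.C y) h3 * algebraMap (MvPowerSeries (Fin 2) A) (blowupAlgebra (Ideal.span (Set.range (![MvPowerSeries.X 0, MvPowerSeries.X 1, MvPowerSeries.C x, MvPowerSeries.C y] : Fin 4 → MvPowerSeries (Fin 2) A))) (MvPowerSeries.C x)) (MvPowerSeries.C (∏ k ∈ S, w k)))}) _ (Ideal.Quotient.mk _ (algebraMap (blowupAlgebra (Ideal.span (Set.range (![MvPowerSeries.X 0, MvPowerSeries.X 1, MvPowerSeries.C x, MvPowerSeries.C y] : Fin 4 → MvPowerSeries (Fin 2) A))) (MvPowerSeries.C x)) L (algebraMap (MvPowerSeries (Fin 2) A) (blowupAlgebra (Ideal.span (Set.range (![MvPowerSeries.X 0, MvPowerSeries.X 1, MvPowerSeries.C x, MvPowerSeries.C y] : Fin 4 → MvPowerSeries (Fin 2) A))) (MvPowerSeries.C x)) (MvPowerSeries.C a))))) =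
      DeJong1996.NodeDeformationRing.ofBase (LocalCpl (Localization.AtPrime 𝔔₁)) _ (((OF1).comp ((algebraMap (blowupAlgebra (Ideal.span (Set.range ![x, y])) x) (Localization.AtPrime 𝔔₁)).comp (algebraMap A (blowupAlgebra (Ideal.span (Set.range ![x, y])) x)))) a) := fun a => by
    have := he₀ (algebraMap A (blowupAlgebra (Ideal.span (Set.range ![x, y])) x) a)
    rw [hlamC] at this
    exact this
  have heE3 : e₀ (algebraMap (L ⧸ Ideal.span {algebraMap (blowupAlgebra (Ideal.span (Set.range (![MvPowerSeries.X 0, MvPowerSeries.X 1, MvPowerSeries.C x, MvPowerSeries.C y] : Fin 4 → MvPowerSeries (Fin 2) A))) (MvPowerSeries.C x)) L (blowupAlgebra.gen (Ideal.span (Set.range (![MvPowerSeries.X 0, MvPowerSeries.X 1, MvPowerSeries.C x, MvPowerSeries.C y] : Fin 4 → MvPowerSeries (Fin 2) A))) (MvPowerSeries.C x) (MvPowerSeries.X 0) h0 * blowupAlgebra.gen (Ideal.span (Set.range (![MvPowerSeries.X 0, MvPowerSeries.X 1, MvPowerSeries.C x, MvPowerSeries.C y] : Fin 4 → MvPowerSeries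 (Fin 2) A))) (MvPowerSeries.C x) (MvPowerSeries.X 1) h1 - blowupAlgebra.gen (Ideal.span (Set.range (![MvPowerSeries.X 0, MvPowerSeries.X 1, MvPowerSeries.C x, MvPowerSeries.C y] : Fin 4 → MvPowerSeries (Fin 2) A))) (MvPowerSeries.C x) (MvPowerSeries.C x) h2 * blowupAlgebra.gen (Ideal.span (Set.range (![MvPowerSeries.X 0, MvPowerSeries.X 1, MvPowerSeries.C x, MvPowerSeries.C y] : Fin 4 → MvPowerSeries (Fin 2) A))) (MvPowerSeries.C x) (MvPowerSeries.C y) h3 * algebraMap (MvPowerSeries (Fin 2) A) (blowupAlgebra (Ideal.span (Set.range (![MvPowerSeries.X 0, MvPowerSeries.X 1, MvPowerSeries.C x, MvPowerSeries.C y] : Fin 4 → MvPowerSeries (Fin 2) A))) (MvPowerSeries.C x)) (MvPowerSeries.C (∏ k ∈ S, w k)))}) _ (Ideal.Quotient.mk _ (algebraMap (blowupAlgebra (Ideal.span (Set.range (![MvPowerSeries.X 0, MvPowerSeries.X 1, MvPowerSeries.C x, MvPowerSeries.C y] : Fin 4 → MvPowerSeries (Fin 2) A))) (MvPowerSeries.C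 x)) L (blowupAlgebra.gen (Ideal.span (Set.range (![MvPowerSeries.X 0, MvPowerSeries.X 1, MvPowerSeries.C x, MvPowerSeries.C y] : Fin 4 → MvPowerSeries (Fin 2) A))) (MvPowerSeries.C x) (MvPowerSeries.C y) h3)))) =
      DeJong1996.NodeDeformationRing.ofBase (LocalCpl (Localization.AtPrime 𝔔₁)) _ (OF1 (algebraMap (blowupAlgebra (Ideal.span (Set.range ![x, y])) x) (Localization.AtPrime 𝔔₁) (blowupAlgebra.gen (Ideal.span (Set.range ![x, y])) x y hy))) := by
    have := he₀ (blowupAlgebra.gen (Ideal.span (Set.range ![x, y])) x y hy)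
    rw [hlam3] at this
    exact this
  by_cases he3 : blowupAlgebra.gen (Ideal.span (Set.range (![MvPowerSeries.X 0, MvPowerSeries.X 1, MvPowerSeries.C x, MvPowerSeries.C y] : Fin 4 → MvPowerSeries (Fin 2) A))) (MvPowerSeries.C x) (MvPowerSeries.C y) h3 ∈ 𝔔
  · -- CASE `y/x ∈ 𝔔`: the full regular system of parameters `(x, y/x, w)` of `Â₁`
    have hSne : S.Nonempty := by
      rcases hν with h | h
      · exact h.2
      · exact Finset.card_pos.mp (by omega)
    let jJ : Fin 1 → {k : Fin 2 // k ≠ 0} := ![⟨1, by decide⟩]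
    have hrs := chartsOverCentre_isRsopPart_chartFamily_of_eq (![x, y] : Fin 2 → A) 0 w hzA hdA (Ideal.span (Set.range ![x, y])) rfl hcA
      x rfl 𝔔₁ hd (Localization.AtPrime 𝔔₁) jJ (Function.injective_of_subsingleton _)
      (fun t => by fin_cases t; exact he3iff.mpr he3)
    have hz' := hOF1rs hrs
    have hz3 : (OF1 ∘ chartFamily (![x, y] : Fin 2 → A) 0 w (Localization.AtPrime 𝔔₁) (algebraMap A (blowupAlgebra (Ideal.span (Set.range ![x, y])) x)) (fun k => blowupAlgebra.gen (Ideal.span (Set.range ![x, y])) x ((![x, y] : Fin 2 → A) k) (hcA k)) jJ) (Fin.castAdd l (0 : Fin 1)).succ = OF1 (algebraMap (blowupAlgebra (Ideal.span (Set.range ![x, y])) x) (Localization.AtPrime 𝔔₁) (blowupAlgebra.gen (Ideal.span (Set.range ![x, y])) x y hy)) := by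
      rw [Function.comp_apply, chartsOverCentre_chartFamily_gen]; rfl
    -- the index sets
    let I : Finset (Fin (1 + l + 1)) := insert (Fin.castAdd l (0 : Fin 1)).succ (S.image fun k => (Fin.natAdd 1 k).succ)
    let J : Finset (Fin (1 + l + 1)) := insert 0 (insert (Fin.castAdd l (0 : Fin 1)).succ (T.image fun k => (Fin.natAdd 1 k).succ))
    have hwinj : Function.Injective (fun k : Fin l => (Fin.natAdd 1 k).succ : Fin l → Fin (1 + l + 1)) := fun k k' h => by
      have := congrArg Fin.val (Fin.succ_injective _ h); simp at this; exact Fin.ext this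
    have h3nm : ∀ U : Finset (Fin l), (Fin.castAdd l (0 : Fin 1)).succ ∉ U.image (fun k => (Fin.natAdd 1 k).succ) := by
      intro U hU
      obtain ⟨k, -, hk⟩ := Finset.mem_image.mp hU
      have := congrArg Fin.val (Fin.succ_injective _ hk); simp at this
    have h0nm : ∀ U : Finset (Fin l), (0 : Fin (1 + l + 1)) ∉ insert (Fin.castAdd l (0 : Fin 1)).succ (U.image (fun k => (Fin.natAdd 1 k).succ)) := by
      intro U hU
      rcases Finset.mem_insert.mp hU with h | h
      · exact Fin.succ_ne_zero _ h.symm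
      · obtain ⟨k, -, hk⟩ := Finset.mem_image.mp h
        exact Fin.succ_ne_zero _ hk
    have hIJ : I ⊆ J := by
      intro i hi
      rcases Finset.mem_insert.mp hi with rfl | h
      · exact Finset.mem_insert_of_mem (Finset.mem_insert_self _ _)
      · obtain ⟨k, hk, rfl⟩ := Finset.mem_image.mp h
        exact Finset.mem_insert_of_mem (Finset.mem_insert_of_mem (Finset.mem_image_of_mem _ (hST hk)))
    have hIcard : I.card = S.card + 1 := by
      rw [Finset.card_insert_of_notMem (h3nm S), Finset.card_image_of_injective _ hwinj]
    have hJcard : J.card = T.card + 2 := by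
      rw [Finset.card_insert_of_notMem (h0nm T), Finset.card_insert_of_notMem (h3nm T),
        Finset.card_image_of_injective _ hwinj]
    obtain ⟨z, hzdef⟩ : ∃ z : Fin (1 + l + 1) → _, z = OF1 ∘ chartFamily (![x, y] : Fin 2 → A) 0 w (Localization.AtPrime 𝔔₁) (algebraMap A (blowupAlgebra (Ideal.span (Set.range ![x, y])) x)) (fun k => blowupAlgebra.gen (Ideal.span (Set.range ![x, y])) x ((![x, y] : Fin 2 → A) k) (hcA k)) jJ := ⟨_, rfl⟩
    have hzrs : IsRsopPart z := hzdef ▸ hz'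
    have hzI : ∏ i ∈ I, z i = OF1 (algebraMap (blowupAlgebra (Ideal.span (Set.range ![x, y])) x) (Localization.AtPrime 𝔔₁) (blowupAlgebra.gen (Ideal.span (Set.range ![x, y])) x y hy)) * ∏ k ∈ S, ((OF1).comp ((algebraMap (blowupAlgebra (Ideal.span (Set.range ![x, y])) x) (Localization.AtPrime 𝔔₁)).comp (algebraMap A (blowupAlgebra (Ideal.span (Set.range ![x, y])) x)))) (w k) := by
      rw [Finset.prod_insert (h3nm S), hzdef, hz3, Finset.prod_image fun k _ k' _ h => hwinj h]
      congr 1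
      exact Finset.prod_congr rfl fun k _ => hzw jJ k
    have hzJ : ∏ i ∈ J, z i = ((OF1).comp ((algebraMap (blowupAlgebra (Ideal.span (Set.range ![x, y])) x) (Localization.AtPrime 𝔔₁)).comp (algebraMap A (blowupAlgebra (Ideal.span (Set.range ![x, y])) x)))) x * (OF1 (algebraMap (blowupAlgebra (Ideal.span (Set.range ![x, y])) x) (Localization.AtPrime 𝔔₁) (blowupAlgebra.gen (Ideal.span (Set.range ![x, y])) x y hy)) * ∏ k ∈ T, ((OF1).comp ((algebraMap (blowupAlgebra (Ideal.span (Set.range ![x, y])) x) (Localization.AtPrime 𝔔₁)).comp (algebraMap A (blowupAlgebra (Ideal.span (Set.range ![x, y])) x)))) (w k)) := by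
      rw [Finset.prod_insert (h0nm T), Finset.prod_insert (h3nm T), hzdef, hz3,
        Finset.prod_image fun k _ k' _ h => hwinj h, Function.comp_apply, hz0]
      congr 2
      exact Finset.prod_congr rfl fun k _ => hzw jJ k
    have hzx : z 0 = ((OF1).comp ((algebraMap (blowupAlgebra (Ideal.span (Set.range ![x, y])) x) (Localization.AtPrime 𝔔₁)).comp (algebraMap A (blowupAlgebra (Ideal.span (Set.range ![x, y])) x)))) x := by rw [hzdef, Function.comp_apply, hz0]
    obtain ⟨σ, hσI, hσJ⟩ := chartsOverCentre_exists_reindex z I J hIJ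
    have hc : l + 2 = 1 + l + 1 := by omega
    obtain ⟨t', ht'⟩ : ∃ t' : Fin (l + 2) → _, t' = (z ∘ σ) ∘ Fin.cast hc := ⟨_, rfl⟩
    have htrs : IsRsopPart t' := by
      rw [ht']; exact (hzrs.comp_equiv σ).comp _ (Fin.cast_injective hc)
    have hspan : Ideal.span (Set.range t') = maximalIdeal (LocalCpl (Localization.AtPrime 𝔔₁)) :=
      chartsOverCentre_span_eq_maximalIdeal_of_ringKrullDim htrs hdimA
    have hSle : S.card + 1 ≤ l + 2 := by
      have := S.card_le_univ; rw [Fintype.card_fin] at this; omega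
    have hTle : T.card + 2 ≤ l + 2 := by
      have := T.card_le_univ; rw [Fintype.card_fin] at this; omega
    have hprodS : ∏ i ∈ Finset.univ.filter (fun i : Fin (l + 2) => i.val < S.card + 1), t' i =
        OF1 (algebraMap (blowupAlgebra (Ideal.span (Set.range ![x, y])) x) (Localization.AtPrime 𝔔₁) (blowupAlgebra.gen (Ideal.span (Set.range ![x, y])) x y hy)) * ∏ k ∈ S, ((OF1).comp ((algebraMap (blowupAlgebra (Ideal.span (Set.range ![x, y])) x) (Localization.AtPrime 𝔔₁)).comp (algebraMap A (blowupAlgebra (Ideal.span (Set.range ![x, y])) x)))) (w k) := by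
      rw [ht', chartsOverCentre_prod_filter_lt_cast hc (z ∘ σ) _ hSle, ← hIcard]
      exact hσI.trans hzI
    have hprodT : ∏ i ∈ Finset.univ.filter (fun i : Fin (l + 2) => i.val < T.card + 2), t' i =
        ((OF1).comp ((algebraMap (blowupAlgebra (Ideal.span (Set.range ![x, y])) x) (Localization.AtPrime 𝔔₁)).comp (algebraMap A (blowupAlgebra (Ideal.span (Set.range ![x, y])) x)))) x * (OF1 (algebraMap (blowupAlgebra (Ideal.span (Set.range ![x, y])) x) (Localization.AtPrime 𝔔₁) (blowupAlgebra.gen (Ideal.span (Set.range ![x, y])) x y hy)) * ∏ k ∈ T, ((OF1).comp ((algebraMap (blowupAlgebra (Ideal.span (Set.range ![x, y])) x) (Localization.AtPrime 𝔔₁)).comp (algebraMap A (blowupAlgebra (Ideal.span (Set.range ![x, y])) x)))) (w k)) := by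
      rw [ht', chartsOverCentre_prod_filter_lt_cast hc (z ∘ σ) _ hTle, ← hJcard]
      exact hσJ.trans hzJ
    -- the relation element
    have hη : OF1 (algebraMap (blowupAlgebra (Ideal.span (Set.range ![x, y])) x) (Localization.AtPrime 𝔔₁) (blowupAlgebra.gen (Ideal.span (Set.range ![x, y])) x y hy * algebraMap A (blowupAlgebra (Ideal.span (Set.range ![x, y])) x) (∏ k ∈ S, w k))) =
        ∏ i ∈ Finset.univ.filter (fun i : Fin (l + 2) => i.val < S.card + 1), t' i := by
      rw [hprodS, map_mul, map_mul, map_prod, map_prod, map_prod]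
      rfl
    refine ⟨LocalCpl (Localization.AtPrime 𝔔₁), inferInstance, hAreg, t', S.card + 1, T.card + 2, ((OF1).comp ((algebraMap (blowupAlgebra (Ideal.span (Set.range ![x, y])) x) (Localization.AtPrime 𝔔₁)).comp (algebraMap A (blowupAlgebra (Ideal.span (Set.range ![x, y])) x)))), OF1 (algebraMap (blowupAlgebra (Ideal.span (Set.range ![x, y])) x) (Localization.AtPrime 𝔔₁) (blowupAlgebra.gen (Ideal.span (Set.range ![x, y])) x y hy)),
      e₀.trans (Ideal.quotEquivOfEq (by rw [← hη, hOF1])),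
      hspan, hdimA, ?_, ?_, by omega, fun a => ?_, ?_, ?_, ?_⟩
    · have := hSne.card_pos; omega
    · have := Finset.card_le_card hST; omega
    · rw [RingEquiv.trans_apply, heC]
      exact Ideal.quotEquivOfEq_mk _ _
    · rw [RingEquiv.trans_apply, heE3]
      exact Ideal.quotEquivOfEq_mk _ _
    · rw [hprodT, map_prod]; ring
    · rw [← hzx]; exact mem_nonZeroDivisors_of_ne_zero (hzrs.ne_zero 0)
  · -- CASE `y/x ∉ 𝔔` (a unit, absorbed into `w_{k₁}`): the regular system of parameters `(x, w, g)`
    have hS2 : 2 ≤ S.card := by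
      rcases hν with h | h
      · exact absurd h.1 he3
      · exact h
    obtain ⟨k₁, hk₁⟩ : S.Nonempty := Finset.card_pos.mp (by omega)
    have hrs := chartsOverCentre_isRsopPart_chartFamily_of_eq (![x, y] : Fin 2 → A) 0 w hzA hdA (Ideal.span (Set.range ![x, y])) rfl hcA
      x rfl 𝔔₁ hd (Localization.AtPrime 𝔔₁) (a := 0) Fin.elim0 (Function.injective_of_subsingleton _)
      (fun t => Fin.elim0 t)
    have hz' := hOF1rs hrs
    obtain ⟨z₀, hz₀def⟩ : ∃ z₀ : Fin (0 + l + 1) → _, z₀ = OF1 ∘ chartFamily (![x, y] : Fin 2 → A) 0 w (Localization.AtPrime 𝔔₁) (algebraMap A (blowupAlgebra (Ideal.span (Set.range ![x, y])) x)) (fun k => blowupAlgebra.gen (Ideal.span (Set.range ![x, y])) x ((![x, y] : Fin 2 → A) k) (hcA k)) Fin.elim0 := ⟨_, rfl⟩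
    have hz₀rs : IsRsopPart z₀ := hz₀def ▸ hz'
    have hz₀x : z₀ 0 = ((OF1).comp ((algebraMap (blowupAlgebra (Ideal.span (Set.range ![x, y])) x) (Localization.AtPrime 𝔔₁)).comp (algebraMap A (blowupAlgebra (Ideal.span (Set.range ![x, y])) x)))) x := by rw [hz₀def, Function.comp_apply, hz0]
    have hz₀w : ∀ k, z₀ (Fin.natAdd 0 k).succ = ((OF1).comp ((algebraMap (blowupAlgebra (Ideal.span (Set.range ![x, y])) x) (Localization.AtPrime 𝔔₁)).comp (algebraMap A (blowupAlgebra (Ideal.span (Set.range ![x, y])) x)))) (w k) := fun k => by rw [hz₀def, Function.comp_apply, hzw]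
    -- extend to a full regular system of parameters: one more member
    obtain ⟨e', xx, hfr, hxxspan, hxx⟩ := hz₀rs.exists_rsop
    have hfr' : (maximalIdeal (LocalCpl (Localization.AtPrime 𝔔₁))).spanFinrank = l + 2 := by
      have h := IsRegularLocalRing.spanFinrank_maximalIdeal (R := LocalCpl (Localization.AtPrime 𝔔₁))
      rw [hdimA] at h
      exact_mod_cast h
    have he' : e' = 1 := by omega
    subst he'
    have hdimA' : ringKrullDim (LocalCpl (Localization.AtPrime 𝔔₁)) = ((0 + l + 1 + 1 : ℕ) : WithBot ℕ∞) := by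
      rw [hdimA]; congr 1; omega
    have hxxrs : IsRsopPart xx := isRsopPart_of_span_eq_of_ringKrullDim_eq xx hxxspan hdimA'
    -- the unit `y/x`
    have hu3 : IsUnit (OF1 (algebraMap (blowupAlgebra (Ideal.span (Set.range ![x, y])) x) (Localization.AtPrime 𝔔₁) (blowupAlgebra.gen (Ideal.span (Set.range ![x, y])) x y hy))) :=
      (IsLocalization.map_units (Localization.AtPrime 𝔔₁) (⟨blowupAlgebra.gen (Ideal.span (Set.range ![x, y])) x y hy, he3iff.not.mpr he3⟩ : 𝔔₁.primeCompl)).map _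
    -- the slots
    let idx : Fin l → Fin (0 + l + 1 + 1) := fun k => Fin.castAdd 1 (Fin.natAdd 0 k).succ
    have hidxinj : Function.Injective idx := fun k k' h => by
      have := congrArg Fin.val h; simp [idx] at this; exact Fin.ext this
    have hidx0 : ∀ U : Finset (Fin l), Fin.castAdd 1 (0 : Fin (0 + l + 1)) ∉ U.image idx := by
      intro U hU
      obtain ⟨k, -, hk⟩ := Finset.mem_image.mp hU
      have := congrArg Fin.val hk; simp [idx] at this
    have hxxw : ∀ k, xx (idx k) = ((OF1).comp ((algebraMap (blowupAlgebra (Ideal.span (Set.range ![x, y])) x) (Localization.AtPrime 𝔔₁)).comp (algebraMap A (blowupAlgebra (Ideal.span (Set.range ![x, y])) x)))) (w k) := fun k => by rw [show idx k = Fin.castAdd 1 _ from rfl, hxx, hz₀w]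
    have hxx0 : xx (Fin.castAdd 1 0) = ((OF1).comp ((algebraMap (blowupAlgebra (Ideal.span (Set.range ![x, y])) x) (Localization.AtPrime 𝔔₁)).comp (algebraMap A (blowupAlgebra (Ideal.span (Set.range ![x, y])) x)))) x := by rw [hxx, hz₀x]
    -- absorb the unit into `w_{k₁}`
    obtain ⟨xx', hxx'j, hxx'ne⟩ := chartsOverCentre_exists_update_mul xx (idx k₁) (OF1 (algebraMap (blowupAlgebra (Ideal.span (Set.range ![x, y])) x) (Localization.AtPrime 𝔔₁) (blowupAlgebra.gen (Ideal.span (Set.range ![x, y])) x y hy)))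
    have hassoc : ∀ i, Associated (xx i) (xx' i) := by
      intro i
      by_cases hi : i = idx k₁
      · rw [hi, hxx'j]; exact (associated_unit_mul_left _ _ hu3).symm
      · rw [hxx'ne i hi]
    have hxx'rs : IsRsopPart xx' := hxxrs.of_associated hassoc
    have hxx'span : Ideal.span (Set.range xx') = maximalIdeal (LocalCpl (Localization.AtPrime 𝔔₁)) := by
      rw [← Ideal.span_range_eq_of_associated hassoc, hxxspan]
    have hxx'k₁ : xx' (idx k₁) = OF1 (algebraMap (blowupAlgebra (Ideal.span (Set.range ![x, y])) x) (Localization.AtPrime 𝔔₁) (blowupAlgebra.gen (Ideal.span (Set.range ![x, y])) x y hy)) * ((OF1).comp ((algebraMap (blowupAlgebra (Ideal.span (Set.range ![x, y])) x) (Localization.AtPrime 𝔔₁)).comp (algebraMap A (blowupAlgebra (Ideal.span (Set.range ![x, y])) x)))) (w k₁) := by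
      rw [hxx'j, hxxw]
    have hxx'w : ∀ k, k ≠ k₁ → xx' (idx k) = ((OF1).comp ((algebraMap (blowupAlgebra (Ideal.span (Set.range ![x, y])) x) (Localization.AtPrime 𝔔₁)).comp (algebraMap A (blowupAlgebra (Ideal.span (Set.range ![x, y])) x)))) (w k) := fun k hk => by
      rw [hxx'ne _ (fun h => hk (hidxinj h)), hxxw]
    have hxx'0 : xx' (Fin.castAdd 1 0) = ((OF1).comp ((algebraMap (blowupAlgebra (Ideal.span (Set.range ![x, y])) x) (Localization.AtPrime 𝔔₁)).comp (algebraMap A (blowupAlgebra (Ideal.span (Set.range ![x, y])) x)))) x := by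
      rw [hxx'ne _ (fun h => hidx0 {k₁} (by rw [h]; simp)), hxx0]
    -- the index sets
    let I : Finset (Fin (0 + l + 1 + 1)) := S.image idx
    let J : Finset (Fin (0 + l + 1 + 1)) := insert (Fin.castAdd 1 0) (T.image idx)
    have hIJ : I ⊆ J := fun i hi => by
      obtain ⟨k, hk, rfl⟩ := Finset.mem_image.mp hi
      exact Finset.mem_insert_of_mem (Finset.mem_image_of_mem _ (hST hk))
    have hIcard : I.card = S.card := Finset.card_image_of_injective _ hidxinj
    have hJcard : J.card = T.card + 1 := by
      rw [Finset.card_insert_of_notMem (hidx0 T), Finset.card_image_of_injective _ hidxinj]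
    have hprodU : ∀ U : Finset (Fin l), k₁ ∈ U →
        ∏ i ∈ U.image idx, xx' i = OF1 (algebraMap (blowupAlgebra (Ideal.span (Set.range ![x, y])) x) (Localization.AtPrime 𝔔₁) (blowupAlgebra.gen (Ideal.span (Set.range ![x, y])) x y hy)) * ∏ k ∈ U, ((OF1).comp ((algebraMap (blowupAlgebra (Ideal.span (Set.range ![x, y])) x) (Localization.AtPrime 𝔔₁)).comp (algebraMap A (blowupAlgebra (Ideal.span (Set.range ![x, y])) x)))) (w k) := by
      intro U hU
      rw [Finset.prod_image fun k _ k' _ h => hidxinj h, ← Finset.mul_prod_erase _ _ hU,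
        ← Finset.mul_prod_erase U _ hU, hxx'k₁, mul_assoc]
      congr 2
      exact Finset.prod_congr rfl fun k hk => hxx'w k (Finset.ne_of_mem_erase hk)
    have hzI : ∏ i ∈ I, xx' i = OF1 (algebraMap (blowupAlgebra (Ideal.span (Set.range ![x, y])) x) (Localization.AtPrime 𝔔₁) (blowupAlgebra.gen (Ideal.span (Set.range ![x, y])) x y hy)) * ∏ k ∈ S, ((OF1).comp ((algebraMap (blowupAlgebra (Ideal.span (Set.range ![x, y])) x) (Localization.AtPrime 𝔔₁)).comp (algebraMap A (blowupAlgebra (Ideal.span (Set.range ![x, y])) x)))) (w k) := hprodU S hk₁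
    have hzJ : ∏ i ∈ J, xx' i = ((OF1).comp ((algebraMap (blowupAlgebra (Ideal.span (Set.range ![x, y])) x) (Localization.AtPrime 𝔔₁)).comp (algebraMap A (blowupAlgebra (Ideal.span (Set.range ![x, y])) x)))) x * (OF1 (algebraMap (blowupAlgebra (Ideal.span (Set.range ![x, y])) x) (Localization.AtPrime 𝔔₁) (blowupAlgebra.gen (Ideal.span (Set.range ![x, y])) x y hy)) * ∏ k ∈ T, ((OF1).comp ((algebraMap (blowupAlgebra (Ideal.span (Set.range ![x, y])) x) (Localization.AtPrime 𝔔₁)).comp (algebraMap A (blowupAlgebra (Ideal.span (Set.range ![x, y])) x)))) (w k)) := by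
      rw [Finset.prod_insert (hidx0 T), hxx'0, hprodU T (hST hk₁)]
    obtain ⟨σ, hσI, hσJ⟩ := chartsOverCentre_exists_reindex xx' I J hIJ
    have hc : l + 2 = 0 + l + 1 + 1 := by omega
    obtain ⟨t', ht'⟩ : ∃ t' : Fin (l + 2) → _, t' = (xx' ∘ σ) ∘ Fin.cast hc := ⟨_, rfl⟩
    have htrs : IsRsopPart t' := by
      rw [ht']; exact (hxx'rs.comp_equiv σ).comp _ (Fin.cast_injective hc)
    have hspan : Ideal.span (Set.range t') = maximalIdeal (LocalCpl (Localization.AtPrime 𝔔₁)) :=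
      chartsOverCentre_span_eq_maximalIdeal_of_ringKrullDim htrs hdimA
    have hSle : S.card ≤ l + 2 := by
      have := S.card_le_univ; rw [Fintype.card_fin] at this; omega
    have hTle : T.card + 1 ≤ l + 2 := by
      have := T.card_le_univ; rw [Fintype.card_fin] at this; omega
    have hprodS : ∏ i ∈ Finset.univ.filter (fun i : Fin (l + 2) => i.val < S.card), t' i =
        OF1 (algebraMap (blowupAlgebra (Ideal.span (Set.range ![x, y])) x) (Localization.AtPrime 𝔔₁) (blowupAlgebra.gen (Ideal.span (Set.range ![x, y])) x y hy)) * ∏ k ∈ S, ((OF1).comp ((algebraMap (blowupAlgebra (Ideal.span (Set.range ![x, y])) x) (Localization.AtPrime 𝔔₁)).comp (algebraMap A (blowupAlgebra (Ideal.span (Set.range ![x, y])) x)))) (w k) := by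
      rw [ht', chartsOverCentre_prod_filter_lt_cast hc (xx' ∘ σ) _ hSle, ← hIcard]
      exact hσI.trans hzI
    have hprodT : ∏ i ∈ Finset.univ.filter (fun i : Fin (l + 2) => i.val < T.card + 1), t' i =
        ((OF1).comp ((algebraMap (blowupAlgebra (Ideal.span (Set.range ![x, y])) x) (Localization.AtPrime 𝔔₁)).comp (algebraMap A (blowupAlgebra (Ideal.span (Set.range ![x, y])) x)))) x * (OF1 (algebraMap (blowupAlgebra (Ideal.span (Set.range ![x, y])) x) (Localization.AtPrime 𝔔₁) (blowupAlgebra.gen (Ideal.span (Set.range ![x, y])) x y hy)) * ∏ k ∈ T, ((OF1).comp ((algebraMap (blowupAlgebra (Ideal.span (Set.range ![x, y])) x) (Localization.AtPrime 𝔔₁)).comp (algebraMap A (blowupAlgebra (Ideal.span (Set.range ![x, y])) x)))) (w k)) := by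
      rw [ht', chartsOverCentre_prod_filter_lt_cast hc (xx' ∘ σ) _ hTle, ← hJcard]
      exact hσJ.trans hzJ
    have hη : OF1 (algebraMap (blowupAlgebra (Ideal.span (Set.range ![x, y])) x) (Localization.AtPrime 𝔔₁) (blowupAlgebra.gen (Ideal.span (Set.range ![x, y])) x y hy * algebraMap A (blowupAlgebra (Ideal.span (Set.range ![x, y])) x) (∏ k ∈ S, w k))) =
        ∏ i ∈ Finset.univ.filter (fun i : Fin (l + 2) => i.val < S.card), t' i := by
      rw [hprodS, map_mul, map_mul, map_prod, map_prod, map_prod]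
      rfl
    refine ⟨LocalCpl (Localization.AtPrime 𝔔₁), inferInstance, hAreg, t', S.card, T.card + 1, ((OF1).comp ((algebraMap (blowupAlgebra (Ideal.span (Set.range ![x, y])) x) (Localization.AtPrime 𝔔₁)).comp (algebraMap A (blowupAlgebra (Ideal.span (Set.range ![x, y])) x)))), OF1 (algebraMap (blowupAlgebra (Ideal.span (Set.range ![x, y])) x) (Localization.AtPrime 𝔔₁) (blowupAlgebra.gen (Ideal.span (Set.range ![x, y])) x y hy)),
      e₀.trans (Ideal.quotEquivOfEq (by rw [← hη, hOF1])),
      hspan, hdimA, hS2, ?_, by omega, fun a => ?_, ?_, ?_, ?_⟩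
    · have := Finset.card_le_card hST; omega
    · rw [RingEquiv.trans_apply, heC]
      exact Ideal.quotEquivOfEq_mk _ _
    · rw [RingEquiv.trans_apply, heE3]
      exact Ideal.quotEquivOfEq_mk _ _
    · rw [hprodT, map_prod]; ring
    · rw [← hxx0]; exact mem_nonZeroDivisors_of_ne_zero (hxxrs.ne_zero _)

end Summit.ResolutionOfSingularities.ResolutionOfSingularities.Theorems

end
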